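import Mathlib
import HarnessLib
import Literature.MathematicalPhysics.QuantumFieldTheory.ConstructiveQFTWave0
import Summits.Ventures.LatticeQCDFlow.Scaling.Conjectures
import Summits.Ventures.LatticeQCDFlow.Scaling.LatticeEntropy
import Summits.Ventures.LatticeQCDFlow.Scaling.LatticeGibbs

/-!
# LatticeQCDFlow / Scaling — (C2a) exact transport is `e^{cβ}`-bi-Lipschitz, from two-sided Haar ball volumes

HONEST FRAMING: exact (Metropolis-corrected) sampling algorithms for lattice gauge theory; figures of merit are
autocorrelation/cost numbers at stated couplings and volumes; no continuum-physics claim.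

Venture `LatticeQCDFlow` (cell pub-lqcd), topic `Scaling`, FANOUT row 30 (lean-1) — OUR WORK.  The conjecture item
`Conjectures.ExactTransportBiLipschitz d N G ρ` ((C2a), THEORY-2.md §3.3) is PROVED here ABSTRACTLY
(`exactTransportBiLipschitz_of_ballVolumes`) for every compact second-countable metric group `G` and continuous
`ρ` with `-N ≤ Re tr ρ ≤ N`, under two hypotheses on the pair `(G, metric, ρ)`:

* (V) TWO-SIDED SMALL-BALL VOLUMES: `a·r^κ ≤ Haar(B̄(g, r)) ≤ A·r^κ` for all centres `g`, all `0 < r ≤ 1`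
  (lower) resp. all `r > 0` (upper), some `κ > 0` — the group "looks `κ`-dimensional to its Haar measure";
* (S) an EXTENSIVE ACTION: for every `L` some configuration has Wilson action `≥ s₀ · L^d` (`s₀ > 0`).

Then `c = s₀/(8κd)` and `β₀ = 16·d·log(A/a)/s₀`, uniformly in `L` (`d ≥ 1`).  The instance `U(N)`, `N ≥ 2`,
`d ≥ 2`, Hilbert–Schmidt metric (`κ = N²`, (V) from `Scaling/LatticeEntropyUN.lean`, (S) with `s₀ = 4` from a
pair of anticommuting Pauli blocks) is `Scaling/ExactTransportUN.lean`.

PROOF (the density-ratio / Jacobian argument of the item's docstring, measure-theoretically): let `T` be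
`K`-Lipschitz and `K′`-co-Lipschitz with `T_*π = μ_β` (`π = Haar^{⊗E}`, sup metric on `G^E`, so
`π(B̄(U,r)) = Π_e Haar(B̄(U_e, r)) ∈ [(a r^κ)^{#E}, (A r^κ)^{#E}]`).  For `y = Tx` and small `r`:
`(a r^κ)^{#E} ≤ π(B̄(x,r)) ≤ μ_β(B̄(y,Kr)) ≤ Z⁻¹e^{-β(S(y)-ε)}(A K^κ r^κ)^{#E}` (Lipschitz image, continuity of
`S`), i.e. `log Z + βS(y) ≤ #E·(log(A/a) + κ log K)`; symmetrically `-log Z - βS(y) ≤ #E·(log(A/a) + κ log K′)`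
from `μ_β(B̄(y,r)) ≤ π(B̄(x,K′r))`.  Since `μ_β` charges every non-empty open set, the image of `T` meets
`{S > s₀L^d/2}` and `{S < s₀L^d/4}`; adding the two inequalities at such points gives
`β·s₀L^d/4 ≤ dL^d·(2 log(A/a) + κ log(KK′))`.  Elementary given the tree; nothing here is cited as a fact.
-/

noncomputable section

namespace Summit.Ventures.LatticeQCDFlow.Theory2.Lattice

open MeasureTheory Metric Set Literature.MathematicalPhysics.QuantumFieldTheory

section ExactTransport

variable {N : ℕ} {G : Type} [Group G] [MetricSpace G] [IsTopologicalGroup G] [CompactSpace G]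
  [SecondCountableTopology G] [MeasurableSpace G] [BorelSpace G]
  (ρ : G →* Matrix (Fin N) (Fin N) ℂ)

omit [SecondCountableTopology G] in
/-- Product Haar measure of a sup-metric ball is the product of the one-link ball volumes. [folklore] -/
theorem pi_closedBall_eq {d L : ℕ} [NeZero L] (U : GaugeConfig d L G) {r : ℝ} (hr : 0 ≤ r) :
    (Measure.pi fun _ : Edge d L => haarProbability G) (closedBall U r) =
      ∏ e, haarProbability G (closedBall (U e) r) := by
  rw [closedBall_pi U hr, Measure.pi_pi]

omit [SecondCountableTopology G] in
/-- Lower volume of a configuration ball from the one-link lower bound. [folklore] -/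
theorem pow_le_pi_closedBall {d L : ℕ} {κ : ℕ} {a : ℝ} (ha : 0 ≤ a)
    (hlo : ∀ (g : G) (r : ℝ), 0 < r → r ≤ 1 → a * r ^ κ ≤ (haarProbability G (closedBall g r)).toReal)
    [NeZero L] (U : GaugeConfig d L G) {r : ℝ} (hr : 0 < r) (hr1 : r ≤ 1) :
    (a * r ^ κ) ^ Fintype.card (Edge d L) ≤
      ((Measure.pi fun _ : Edge d L => haarProbability G) (closedBall U r)).toReal := by
  rw [pi_closedBall_eq U hr.le, ENNReal.toReal_prod, ← Finset.card_univ, ← Finset.prod_const]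
  exact Finset.prod_le_prod (fun _ _ => by positivity) fun e _ => hlo (U e) r hr hr1

omit [SecondCountableTopology G] in
/-- Upper volume of a configuration ball from the one-link upper bound. [folklore] -/
theorem pi_closedBall_le_pow {d L : ℕ} {κ : ℕ} {A : ℝ}
    (hup : ∀ (g : G) (r : ℝ), 0 < r → (haarProbability G (closedBall g r)).toReal ≤ A * r ^ κ)
    [NeZero L] (U : GaugeConfig d L G) {r : ℝ} (hr : 0 < r) :
    ((Measure.pi fun _ : Edge d L => haarProbability G) (closedBall U r)).toReal ≤
      (A * r ^ κ) ^ Fintype.card (Edge d L) := by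
  rw [pi_closedBall_eq U hr.le, ENNReal.toReal_prod, ← Finset.card_univ, ← Finset.prod_const]
  exact Finset.prod_le_prod (fun _ _ => ENNReal.toReal_nonneg) fun e _ => hup (U e) r hr

omit [SecondCountableTopology G] in
/-- The Wilson weight of a set on which `S ≥ s₁`: `W_β(B) ≤ e^{-βs₁}·π(B)` (`β ≥ 0`). [folklore] -/
theorem wilsonWeight_le_of_le {d L : ℕ} [NeZero L]
    {β : ℝ} (hβ : 0 ≤ β) {B : Set (GaugeConfig d L G)} (hB : MeasurableSet B) {s₁ : ℝ}
    (hS : ∀ U ∈ B, s₁ ≤ wilsonAction ρ U) :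
    wilsonWeight (d := d) (L := L) ρ β B ≤
      ENNReal.ofReal (Real.exp (-(β * s₁))) * (Measure.pi fun _ : Edge d L => haarProbability G) B := by
  unfold wilsonWeight
  rw [withDensity_apply _ hB]
  calc ∫⁻ U in B, ENNReal.ofReal (Real.exp (-β * wilsonAction ρ U))
        ∂(Measure.pi fun _ : Edge d L => haarProbability G)
      ≤ ∫⁻ _ in B, ENNReal.ofReal (Real.exp (-(β * s₁))) ∂(Measure.pi fun _ : Edge d L => haarProbability G) :=
        setLIntegral_mono' hB fun U hU =>
          ENNReal.ofReal_le_ofReal (Real.exp_le_exp.2 (by nlinarith [hS U hU]))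
    _ = _ := setLIntegral_const _ _

omit [SecondCountableTopology G] in
/-- The Wilson weight of a set on which `S ≤ s₂`: `e^{-βs₂}·π(B) ≤ W_β(B)` (`β ≥ 0`). [folklore] -/
theorem le_wilsonWeight_of_le {d L : ℕ} [NeZero L]
    {β : ℝ} (hβ : 0 ≤ β) {B : Set (GaugeConfig d L G)} (hB : MeasurableSet B) {s₂ : ℝ}
    (hS : ∀ U ∈ B, wilsonAction ρ U ≤ s₂) :
    ENNReal.ofReal (Real.exp (-(β * s₂))) * (Measure.pi fun _ : Edge d L => haarProbability G) B ≤
      wilsonWeight (d := d) (L := L) ρ β B := by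
  unfold wilsonWeight
  rw [withDensity_apply _ hB, ← setLIntegral_const]
  exact setLIntegral_mono' hB fun U hU =>
    ENNReal.ofReal_le_ofReal (Real.exp_le_exp.2 (by nlinarith [hS U hU]))

omit [SecondCountableTopology G] in
/-- The Wilson measure charges every set of positive prior measure (`β ≥ 0`, `-N ≤ Re tr ρ`). [folklore] -/
theorem wilsonMeasure_pos_of_pi_pos {d L : ℕ} [NeZero L]
    (htr : ∀ g, (ρ g).trace.re ≤ N) (htr' : ∀ g, -(N : ℝ) ≤ (ρ g).trace.re) {β : ℝ} (hβ : 0 ≤ β)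
    {B : Set (GaugeConfig d L G)} (hB : MeasurableSet B)
    (hpos : 0 < (Measure.pi fun _ : Edge d L => haarProbability G) B) :
    0 < wilsonMeasure (d := d) (L := L) ρ β B := by
  have hZtop : partitionFunction (d := d) (L := L) ρ β ≠ ⊤ :=
    ne_top_of_le_ne_top ENNReal.one_ne_top (partitionFunction_le_one ρ htr hβ)
  -- `S ≤ 2N·#P` everywhere
  have hS : ∀ U ∈ B, wilsonAction ρ U ≤ 2 * N * Fintype.card (Plaquette d L) := by
    intro U _
    unfold wilsonAction
    calc ∑ p : Plaquette d L, ((N : ℝ) - (ρ (plaquetteHolonomy U p.1 p.2.1.1 p.2.1.2)).trace.re)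
        ≤ ∑ _p : Plaquette d L, (2 * N : ℝ) :=
          Finset.sum_le_sum fun p _ => by linarith [htr' (plaquetteHolonomy U p.1 p.2.1.1 p.2.1.2)]
      _ = _ := by rw [Finset.sum_const, Finset.card_univ, nsmul_eq_mul]; ring
  have h := le_wilsonWeight_of_le ρ hβ hB hS
  show 0 < ((partitionFunction ρ β)⁻¹ • wilsonWeight ρ β) B
  rw [Measure.smul_apply, smul_eq_mul]
  refine ENNReal.mul_pos (ENNReal.inv_ne_zero.2 hZtop) (ne_of_gt (lt_of_lt_of_le ?_ h))
  exact ENNReal.mul_pos (by positivity) hpos.ne'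

/-- **(C2a) FROM BALL VOLUMES AND AN EXTENSIVE ACTION** (OURS).  See the module docstring. [folklore] -/
theorem exactTransportBiLipschitz_of_ballVolumes (d : ℕ) (hd : 1 ≤ d)
    (hρ : Continuous (ρ : G → Matrix (Fin N) (Fin N) ℂ))
    (htr : ∀ g, (ρ g).trace.re ≤ N) (htr' : ∀ g, -(N : ℝ) ≤ (ρ g).trace.re)
    {κ : ℕ} (hκ : 0 < κ) {a A : ℝ} (ha : 0 < a)
    (hlo : ∀ (g : G) (r : ℝ), 0 < r → r ≤ 1 → a * r ^ κ ≤ (haarProbability G (closedBall g r)).toReal)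
    (hup : ∀ (g : G) (r : ℝ), 0 < r → (haarProbability G (closedBall g r)).toReal ≤ A * r ^ κ)
    {s₀ : ℝ} (hs₀ : 0 < s₀)
    (hconf : ∀ (L : ℕ) [NeZero L], ∃ V : GaugeConfig d L G, s₀ * (L : ℝ) ^ d ≤ wilsonAction ρ V) :
    Conjectures.ExactTransportBiLipschitz d N G ρ := by
  have haA : a ≤ A := by
    have h1 := hlo 1 1 one_pos le_rfl
    have h2 := hup 1 1 one_pos
    rw [one_pow, mul_one] at h1 h2
    exact h1.trans h2
  have hA : 0 < A := ha.trans_le haA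
  have hlogAa : 0 ≤ Real.log (A / a) := Real.log_nonneg ((one_le_div ha).2 haA)
  refine ⟨s₀ / (8 * κ * d), by positivity, 16 * d * Real.log (A / a) / s₀, fun L _ β hβ T K K' hT hT' hmap => ?_⟩
  have hβ0 : 0 ≤ β := le_trans (by positivity) hβ
  have hκr : (0 : ℝ) < κ := by exact_mod_cast hκ
  have hdr : (1 : ℝ) ≤ d := by exact_mod_cast hd
  have hL1 : (1 : ℝ) ≤ L := by exact_mod_cast (NeZero.one_le : 1 ≤ L)
  have hLd : (1 : ℝ) ≤ (L : ℝ) ^ d := one_le_pow₀ hL1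
  set π : Measure (GaugeConfig d L G) := Measure.pi fun _ : Edge d L => haarProbability G with hπ
  set S : GaugeConfig d L G → ℝ := wilsonAction (d := d) (L := L) ρ with hSdef
  have hScont : Continuous S := continuous_wilsonAction (d := d) (L := L) ρ hρ
  have hTm : Measurable T := hT.continuous.measurable
  -- cardinalities
  have hEn : Fintype.card (Edge d L) = L ^ d * d := by simp [Fintype.card_prod, ZMod.card, Fintype.card_fin]
  have hE : (Fintype.card (Edge d L) : ℝ) = d * (L : ℝ) ^ d := by rw [hEn]; push_cast; ring
  set nE : ℕ := Fintype.card (Edge d L) with hnE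
  have hnE0 : (0 : ℝ) < nE := by rw [hnE, hE]; positivity
  -- the partition function
  have hZ0 : partitionFunction (d := d) (L := L) ρ β ≠ 0 := partitionFunction_ne_zero ρ hρ β
  have hZtop : partitionFunction (d := d) (L := L) ρ β ≠ ⊤ :=
    ne_top_of_le_ne_top ENNReal.one_ne_top (partitionFunction_le_one ρ htr hβ0)
  set Z : ℝ := (partitionFunction (d := d) (L := L) ρ β).toReal with hZdef
  have hZpos : 0 < Z := ENNReal.toReal_pos hZ0 hZtop
  -- two distinct configurations: the identity and a high-action one
  obtain ⟨Vhi, hVhi⟩ := hconf L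
  set V₁ : GaugeConfig d L G := fun _ => 1 with hV₁
  have hS1 : S V₁ = 0 := by
    simp only [hSdef, hV₁, wilsonAction, plaquetteHolonomy, mul_one, inv_one, map_one, Matrix.trace_one,
      Fintype.card_fin]
    simp
  have hs₀L : 0 < s₀ * (L : ℝ) ^ d := by positivity
  have hne : Vhi ≠ V₁ := by
    intro h; rw [h] at hVhi; rw [← hSdef, hS1] at hVhi; linarith
  -- `1 ≤ K·K'`, hence `K, K' > 0`
  have hKK : (1 : ℝ) ≤ K * K' := by
    have h1 : dist Vhi V₁ ≤ K' * dist (T Vhi) (T V₁) := hT'.le_mul_dist Vhi V₁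
    have h2 : dist (T Vhi) (T V₁) ≤ K * dist Vhi V₁ := hT.dist_le_mul Vhi V₁
    have hpos : 0 < dist Vhi V₁ := dist_pos.2 hne
    have h3 : dist Vhi V₁ ≤ K' * K * dist Vhi V₁ := by
      calc _ ≤ K' * dist (T Vhi) (T V₁) := h1
        _ ≤ K' * (K * dist Vhi V₁) := mul_le_mul_of_nonneg_left h2 K'.coe_nonneg
        _ = _ := by ring
    nlinarith
  have hK0 : (0 : ℝ) < K := by
    rcases K.coe_nonneg.eq_or_lt with h | h
    · rw [← h, zero_mul] at hKK; linarith
    · exact h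
  have hK'0 : (0 : ℝ) < K' := by
    rcases K'.coe_nonneg.eq_or_lt with h | h
    · rw [← h, mul_zero] at hKK; linarith
    · exact h
  -- μ of a measurable set as the prior mass of its preimage
  have hμT : ∀ B : Set (GaugeConfig d L G), MeasurableSet B →
      wilsonMeasure (d := d) (L := L) ρ β B = π (T ⁻¹' B) := fun B hB => by
    rw [← hmap, Measure.map_apply hTm hB]
  have hμW : ∀ B : Set (GaugeConfig d L G),
      wilsonMeasure (d := d) (L := L) ρ β B = (partitionFunction ρ β)⁻¹ * wilsonWeight ρ β B := fun B => by
    show ((partitionFunction ρ β)⁻¹ • wilsonWeight ρ β) B = _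
    rw [Measure.smul_apply, smul_eq_mul]
  -- STEP 1: `log Z + β S(Tx) ≤ nE (log(A/a) + κ log K)`
  have step1 : ∀ x, Real.log Z + β * S (T x) ≤ nE * (Real.log (A / a) + κ * Real.log K) := by
    intro x
    refine le_of_forall_pos_le_add fun ε hε => ?_
    have hε' : 0 < ε / (β + 1) := by positivity
    have hβε : β * (ε / (β + 1)) ≤ ε := by
      rw [mul_div_assoc', div_le_iff₀ (by positivity)]; nlinarith
    obtain ⟨δ, hδ, hδS⟩ := Metric.continuous_iff.1 hScont (T x) (ε / (β + 1)) hε'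
    set r : ℝ := min 1 (δ / (2 * K)) with hr
    have hr0 : 0 < r := lt_min one_pos (by positivity)
    have hr1 : r ≤ 1 := min_le_left _ _
    have hKr : K * r < δ := by
      have : r ≤ δ / (2 * K) := min_le_right _ _
      calc (K : ℝ) * r ≤ K * (δ / (2 * K)) := mul_le_mul_of_nonneg_left this hK0.le
        _ = δ / 2 := by field_simp
        _ < δ := by linarith
    -- (i) lower volume of `B̄(x, r)`
    have h1 := pow_le_pi_closedBall ha.le hlo x hr0 hr1
    -- (ii) `π(B̄(x,r)) ≤ μ(B̄(Tx, K r))`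
    have hsub : closedBall x r ⊆ T ⁻¹' closedBall (T x) (K * r) := fun u hu => by
      rw [mem_preimage, mem_closedBall]
      exact (hT.dist_le_mul u x).trans (mul_le_mul_of_nonneg_left (mem_closedBall.1 hu) K.coe_nonneg)
    have h2 : π (closedBall x r) ≤ wilsonMeasure (d := d) (L := L) ρ β (closedBall (T x) (K * r)) := by
      rw [hμT _ measurableSet_closedBall]; exact measure_mono hsub
    -- (iii) `μ(B̄(Tx, Kr)) ≤ Z⁻¹ e^{-β(S(Tx) - ε)} (A (Kr)^κ)^{nE}`
    have hSB : ∀ U ∈ closedBall (T x) (K * r), S (T x) - ε / (β + 1) ≤ S U := fun U hU => by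
      have hd : dist U (T x) < δ := lt_of_le_of_lt (mem_closedBall.1 hU) hKr
      have := hδS U hd
      rw [Real.dist_eq] at this
      linarith [(abs_lt.1 this).1]
    have h3 := wilsonWeight_le_of_le ρ hβ0 measurableSet_closedBall hSB
    have h4 := pi_closedBall_le_pow hup (T x) (mul_pos hK0 hr0)
    -- assemble in `ℝ`
    have hfin : (partitionFunction (d := d) (L := L) ρ β)⁻¹ *
        (ENNReal.ofReal (Real.exp (-(β * (S (T x) - ε / (β + 1))))) * π (closedBall (T x) (K * r))) ≠ ⊤ :=
      ENNReal.mul_ne_top (ENNReal.inv_ne_top.2 hZ0) (ENNReal.mul_ne_top ENNReal.ofReal_ne_top (measure_ne_top _ _))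
    have hchain : (π (closedBall x r)).toReal ≤
        Z⁻¹ * (Real.exp (-(β * (S (T x) - ε / (β + 1)))) * (A * (K * r) ^ κ) ^ nE) := by
      have h5 : π (closedBall x r) ≤ (partitionFunction (d := d) (L := L) ρ β)⁻¹ *
          (ENNReal.ofReal (Real.exp (-(β * (S (T x) - ε / (β + 1))))) * π (closedBall (T x) (K * r))) :=
        h2.trans (by rw [hμW]; exact mul_le_mul' le_rfl h3)
      have h6 := ENNReal.toReal_mono hfin h5
      rw [ENNReal.toReal_mul, ENNReal.toReal_mul, ENNReal.toReal_inv, ENNReal.toReal_ofReal (Real.exp_pos _).le]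
        at h6
      refine h6.trans (mul_le_mul_of_nonneg_left (mul_le_mul_of_nonneg_left h4 (Real.exp_pos _).le) ?_)
      exact inv_nonneg.2 hZpos.le
    have h7 : (a * r ^ κ) ^ nE ≤
        Z⁻¹ * (Real.exp (-(β * (S (T x) - ε / (β + 1)))) * (A * (K * r) ^ κ) ^ nE) := h1.trans hchain
    -- logarithms
    have hlhs : 0 < (a * r ^ κ) ^ nE := by positivity
    have h8 := Real.log_le_log hlhs h7
    rw [Real.log_pow, Real.log_mul ha.ne' (pow_pos hr0 _).ne', Real.log_pow,
      Real.log_mul (inv_pos.2 hZpos).ne' (by positivity), Real.log_inv,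
      Real.log_mul (Real.exp_pos _).ne' (by positivity), Real.log_exp, Real.log_pow,
      Real.log_mul hA.ne' (by positivity), Real.log_pow, Real.log_mul hK0.ne' hr0.ne'] at h8
    rw [Real.log_div hA.ne' ha.ne']
    linarith only [h8, hβε]
  -- STEP 2: `-log Z - β S(Tx) ≤ nE (log(A/a) + κ log K')`
  have step2 : ∀ x, -Real.log Z - β * S (T x) ≤ nE * (Real.log (A / a) + κ * Real.log K') := by
    intro x
    refine le_of_forall_pos_le_add fun ε hε => ?_
    have hε' : 0 < ε / (β + 1) := by positivity
    have hβε : β * (ε / (β + 1)) ≤ ε := by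
      rw [mul_div_assoc', div_le_iff₀ (by positivity)]; nlinarith
    obtain ⟨δ, hδ, hδS⟩ := Metric.continuous_iff.1 hScont (T x) (ε / (β + 1)) hε'
    set r : ℝ := min 1 (δ / 2) with hr
    have hr0 : 0 < r := lt_min one_pos (by positivity)
    have hr1 : r ≤ 1 := min_le_left _ _
    have hrδ : r < δ := lt_of_le_of_lt (min_le_right _ _) (by linarith)
    -- (i) `μ(B̄(Tx, r)) ≤ π(B̄(x, K' r)) ≤ (A (K' r)^κ)^{nE}`
    have hsub : T ⁻¹' closedBall (T x) r ⊆ closedBall x (K' * r) := fun u hu => by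
      rw [mem_preimage, mem_closedBall] at hu
      rw [mem_closedBall]
      exact (hT'.le_mul_dist u x).trans (mul_le_mul_of_nonneg_left hu K'.coe_nonneg)
    have h2 : wilsonMeasure (d := d) (L := L) ρ β (closedBall (T x) r) ≤ π (closedBall x (K' * r)) := by
      rw [hμT _ measurableSet_closedBall]; exact measure_mono hsub
    have h4 := pi_closedBall_le_pow hup x (mul_pos hK'0 hr0)
    -- (ii) `Z⁻¹ e^{-β(S(Tx)+ε)} (a r^κ)^{nE} ≤ μ(B̄(Tx, r))`
    have hSB : ∀ U ∈ closedBall (T x) r, S U ≤ S (T x) + ε / (β + 1) := fun U hU => by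
      have hd : dist U (T x) < δ := lt_of_le_of_lt (mem_closedBall.1 hU) hrδ
      have := hδS U hd
      rw [Real.dist_eq] at this
      linarith [(abs_lt.1 this).2]
    have h3 := le_wilsonWeight_of_le ρ hβ0 measurableSet_closedBall hSB
    have h1 := pow_le_pi_closedBall ha.le hlo (T x) hr0 hr1
    have hchain : Z⁻¹ * (Real.exp (-(β * (S (T x) + ε / (β + 1)))) * (a * r ^ κ) ^ nE) ≤
        (π (closedBall x (K' * r))).toReal := by
      have h5 : (partitionFunction (d := d) (L := L) ρ β)⁻¹ *
          (ENNReal.ofReal (Real.exp (-(β * (S (T x) + ε / (β + 1))))) * π (closedBall (T x) r)) ≤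
            π (closedBall x (K' * r)) :=
        le_trans (by rw [hμW]; exact mul_le_mul' le_rfl h3) h2
      have h6 := ENNReal.toReal_mono (measure_ne_top _ _) h5
      rw [ENNReal.toReal_mul, ENNReal.toReal_mul, ENNReal.toReal_inv, ENNReal.toReal_ofReal (Real.exp_pos _).le]
        at h6
      refine le_trans (mul_le_mul_of_nonneg_left (mul_le_mul_of_nonneg_left h1 (Real.exp_pos _).le) ?_) h6
      exact inv_nonneg.2 hZpos.le
    have h7 : Z⁻¹ * (Real.exp (-(β * (S (T x) + ε / (β + 1)))) * (a * r ^ κ) ^ nE) ≤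
        (A * (K' * r) ^ κ) ^ nE := hchain.trans h4
    have hlhs : 0 < Z⁻¹ * (Real.exp (-(β * (S (T x) + ε / (β + 1)))) * (a * r ^ κ) ^ nE) := by positivity
    have h8 := Real.log_le_log hlhs h7
    rw [Real.log_mul (inv_pos.2 hZpos).ne' (by positivity), Real.log_inv,
      Real.log_mul (Real.exp_pos _).ne' (by positivity), Real.log_exp, Real.log_pow,
      Real.log_mul ha.ne' (pow_pos hr0 _).ne', Real.log_pow, Real.log_pow,
      Real.log_mul hA.ne' (by positivity), Real.log_pow, Real.log_mul hK'0.ne' hr0.ne'] at h8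
    rw [Real.log_div hA.ne' ha.ne']
    linarith only [h8, hβε]
  -- STEP 3: points of the image of `T` with large / small action
  haveI : (haarProbability G).IsHaarMeasure := Measure.isHaarMeasure_haarMeasure _
  have himage : ∀ (O : Set (GaugeConfig d L G)), IsOpen O → O.Nonempty → ∃ x, T x ∈ O := by
    intro O hO hne
    have hpos : 0 < wilsonMeasure (d := d) (L := L) ρ β O :=
      wilsonMeasure_pos_of_pi_pos ρ htr htr' hβ0 hO.measurableSet (hO.measure_pos π hne)
    rw [hμT O hO.measurableSet] at hpos
    exact nonempty_of_measure_ne_zero hpos.ne'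
  obtain ⟨x₁, hx₁⟩ := himage {U | s₀ * (L : ℝ) ^ d / 2 < S U} (isOpen_lt continuous_const hScont)
    ⟨Vhi, by show s₀ * (L : ℝ) ^ d / 2 < S Vhi; rw [hSdef]; linarith⟩
  obtain ⟨x₂, hx₂⟩ := himage {U | S U < s₀ * (L : ℝ) ^ d / 4} (isOpen_lt hScont continuous_const)
    ⟨V₁, by show S V₁ < s₀ * (L : ℝ) ^ d / 4; rw [hS1]; positivity⟩
  have hx₁' : s₀ * (L : ℝ) ^ d / 2 < S (T x₁) := hx₁
  have hx₂' : S (T x₂) < s₀ * (L : ℝ) ^ d / 4 := hx₂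
  -- STEP 4: combine
  have hsum := add_le_add (step1 x₁) (step2 x₂)
  have hlogKK : Real.log ((K : ℝ) * K') = Real.log K + Real.log K' := Real.log_mul hK0.ne' hK'0.ne'
  have key : β * (s₀ / (8 * κ * d)) ≤ Real.log ((K : ℝ) * K') := by
    rw [hlogKK]
    -- `β s₀ L^d / 4 ≤ nE (2 log(A/a) + κ (log K + log K'))`, `nE = d L^d`, `β ≥ 16 d log(A/a)/s₀`
    have hn : (nE : ℝ) = d * (L : ℝ) ^ d := by rw [hnE, hE]
    rw [hn] at hsum
    have hβ' : 16 * d * Real.log (A / a) ≤ β * s₀ := by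
      have := mul_le_mul_of_nonneg_right hβ hs₀.le
      rwa [div_mul_cancel₀ _ hs₀.ne'] at this
    have hLd0 : (0 : ℝ) < (L : ℝ) ^ d := by positivity
    have hdk : (0 : ℝ) < 8 * κ * d := by positivity
    rw [mul_div_assoc', div_le_iff₀ hdk]
    nlinarith only [hsum, hx₁', hx₂', hβ', hLd0, hκr, hdr, hlogAa, hβ0, hs₀]
  calc Real.exp (s₀ / (8 * κ * d) * β) = Real.exp (β * (s₀ / (8 * κ * d))) := by rw [mul_comm]
    _ ≤ Real.exp (Real.log ((K : ℝ) * K')) := Real.exp_le_exp.2 key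
    _ = (K : ℝ) * K' := Real.exp_log (mul_pos hK0 hK'0)

end ExactTransport

end Summit.Ventures.LatticeQCDFlow.Theory2.Lattice

end
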